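import Mathlib

/-!
# Crux `LaminatedThreshold` (stmt-FinalStateConjecture-16893) — crux-ideate round 1, ideator 1:
# first lemmas of the three idea cards (they elaborate; two of them are proved here).

* `CageLemma`        — card `equivariant-cage`   (proved: `cageLemma_holds`)
* `ScalingPigeonhole`— card `mixed-branches`      (proved: `scalingPigeonhole_holds`)
* `ConeCombLemma`    — card `energy-cones`        (statement only; the two-norm, cone-field
                        version of `Lines/heteroclinic_comb.lean`'s `CombLemma`)

Mathlib only (the three levers are abstract dynamics; the GR dictionary is on the cards).
-/

noncomputable section

set_option linter.dupNamespace false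

namespace Summit.FinalStateConjecture.FinalStateConjecture.Cruxes.LaminatedThreshold.Ideas

open Set Filter Topology

/-! ## Card `equivariant-cage`: the linear cage lemma

`P` is the (continuous, idempotent) projection onto the symmetric subspace (averaging over the
compact symmetry group), commuting with the linearised period map `L`. Hypotheses: on the
symmetric subspace `L` has the comb form (a complemented `L`-invariant stable subspace `Vs`
contracted by `θ < 1`; the expanding direction is not needed for this statement), and the
non-symmetric part `ker P` is uniformly contracted ("all `m ≠ 0` modes decay"). Conclusion: the
whole complement `Vs + ker P` of the expanding direction is uniformly exponentially contracted, so
an iterate `T^N` of the FULL map has the `(S, μ^N)`, `‖S‖ < 1` form demanded by `CombLemma`. -/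
def CageLemma : Prop :=
  ∀ (E : Type) [NormedAddCommGroup E] [NormedSpace ℝ E] [CompleteSpace E]
    (L P : E →L[ℝ] E) (Vs : Submodule ℝ E) (θ : ℝ),
    0 ≤ θ → (∀ x, P (P x) = P x) → (∀ x, L (P x) = P (L x)) →
    (∀ v ∈ Vs, P v = v) → (∀ v ∈ Vs, L v ∈ Vs) → (∀ v ∈ Vs, ‖L v‖ ≤ θ * ‖v‖) →
    (∀ w, P w = 0 → ‖L w‖ ≤ θ * ‖w‖) →
    ∀ x, (∃ v ∈ Vs, ∃ w, P w = 0 ∧ x = v + w) →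
      ∀ n : ℕ, ‖(L ^ n) x‖ ≤ (‖P‖ + ‖ContinuousLinearMap.id ℝ E - P‖) * θ ^ n * ‖x‖

theorem cageLemma_holds : CageLemma := by
  intro E _ _ _ L P Vs θ hθ hPP hcomm hPV hLV hLVs hLW x hx
  obtain ⟨v, hv, w, hw, rfl⟩ := hx
  -- contraction on the symmetric stable space
  have hVs : ∀ n : ℕ, ∀ u ∈ Vs, (L ^ n) u ∈ Vs ∧ ‖(L ^ n) u‖ ≤ θ ^ n * ‖u‖ := by
    intro n
    induction n with
    | zero => intro u hu; simp [hu]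
    | succ n ih =>
      intro u hu
      obtain ⟨hmem, hle⟩ := ih u hu
      refine ⟨?_, ?_⟩
      · rw [pow_succ', ContinuousLinearMap.mul_apply]; exact hLV _ hmem
      · rw [pow_succ', ContinuousLinearMap.mul_apply]
        calc ‖L ((L ^ n) u)‖ ≤ θ * ‖(L ^ n) u‖ := hLVs _ hmem
          _ ≤ θ * (θ ^ n * ‖u‖) := by gcongr
          _ = θ ^ (n + 1) * ‖u‖ := by ring
  -- contraction on the non-symmetric part
  have hW : ∀ n : ℕ, ∀ u, P u = 0 → P ((L ^ n) u) = 0 ∧ ‖(L ^ n) u‖ ≤ θ ^ n * ‖u‖ := by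
    intro n
    induction n with
    | zero => intro u hu; simp [hu]
    | succ n ih =>
      intro u hu
      obtain ⟨hPu, hle⟩ := ih u hu
      refine ⟨?_, ?_⟩
      · rw [pow_succ', ContinuousLinearMap.mul_apply, ← hcomm, hPu, map_zero]
      · rw [pow_succ', ContinuousLinearMap.mul_apply]
        calc ‖L ((L ^ n) u)‖ ≤ θ * ‖(L ^ n) u‖ := hLW _ hPu
          _ ≤ θ * (θ ^ n * ‖u‖) := by gcongr
          _ = θ ^ (n + 1) * ‖u‖ := by ring
  intro n
  have hPx : P (v + w) = v := by rw [map_add, hPV v hv, hw, add_zero]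
  have hnv : ‖v‖ ≤ ‖P‖ * ‖v + w‖ := by
    have h := P.le_opNorm (v + w)
    rwa [hPx] at h
  have hnw : ‖w‖ ≤ ‖ContinuousLinearMap.id ℝ E - P‖ * ‖v + w‖ := by
    have h := (ContinuousLinearMap.id ℝ E - P).le_opNorm (v + w)
    have hid : (ContinuousLinearMap.id ℝ E - P) (v + w) = w := by simp [hPx]
    rwa [hid] at h
  have h1 := (hVs n v hv).2
  have h2 := (hW n w hw).2
  have hθn : 0 ≤ θ ^ n := pow_nonneg hθ n
  calc ‖(L ^ n) (v + w)‖ = ‖(L ^ n) v + (L ^ n) w‖ := by rw [map_add]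
    _ ≤ ‖(L ^ n) v‖ + ‖(L ^ n) w‖ := norm_add_le _ _
    _ ≤ θ ^ n * ‖v‖ + θ ^ n * ‖w‖ := add_le_add h1 h2
    _ ≤ θ ^ n * (‖P‖ * ‖v + w‖) + θ ^ n * (‖ContinuousLinearMap.id ℝ E - P‖ * ‖v + w‖) := by
        gcongr
    _ = (‖P‖ + ‖ContinuousLinearMap.id ℝ E - P‖) * θ ^ n * ‖v + w‖ := by ring

/-! ## Card `mixed-branches`: the scaling pigeonhole on an unstable half-axis

`D` = parameters on the unstable half-axis whose evolution DISPERSES, `T` = those which form a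
TRAPPED SURFACE; both open (Cauchy stability), disjoint (Penrose vs completeness), invariant under
the period scaling `t ↦ μ t` (same spacetime, one echo later). If both occur, then arbitrarily
close to the saddle there is a parameter in neither: its orbit is exceptional (a good datum either
disperses or, being sub-extremal, traps) — this is the seed the comb lemma needs on that side. -/
def ScalingPigeonhole : Prop :=
  ∀ (μ : ℝ) (D T : Set ℝ), 1 < μ → IsOpen D → IsOpen T → Disjoint D T →
    (∀ t : ℝ, t ∈ D ↔ μ * t ∈ D) → (∀ t : ℝ, t ∈ T ↔ μ * t ∈ T) →
    (D ∩ Set.Ioi 0).Nonempty → (T ∩ Set.Ioi 0).Nonempty →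
    ∀ r : ℝ, 0 < r → ∃ t ∈ Set.Ioo 0 r, t ∉ D ∧ t ∉ T

theorem scalingPigeonhole_holds : ScalingPigeonhole := by
  intro μ D T hμ hDo hTo hdisj hDinv hTinv hD hT r hr
  -- a positive parameter in neither set (connectedness of the half-axis)
  have key : ∃ t₀ : ℝ, 0 < t₀ ∧ t₀ ∉ D ∧ t₀ ∉ T := by
    by_contra h
    push_neg at h
    have hsub : Set.Ioi (0 : ℝ) ⊆ D ∪ T := by
      intro t ht
      by_cases htD : t ∈ D
      · exact Or.inl htD
      · exact Or.inr (h t ht htD)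
    have hD' : (Set.Ioi (0 : ℝ) ∩ D).Nonempty := by rwa [Set.inter_comm]
    have hT' : (Set.Ioi (0 : ℝ) ∩ T).Nonempty := by rwa [Set.inter_comm]
    obtain ⟨x, -, hxD, hxT⟩ := isPreconnected_Ioi D T hDo hTo hsub hD' hT'
    exact Set.disjoint_left.1 hdisj hxD hxT
  obtain ⟨t₀, ht₀, ht₀D, ht₀T⟩ := key
  have hμ0 : 0 < μ := lt_trans zero_lt_one hμ
  -- push it down by the scaling
  have hdown : ∀ n : ℕ, t₀ / μ ^ n ∉ D ∧ t₀ / μ ^ n ∉ T := by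
    intro n
    induction n with
    | zero => simpa using And.intro ht₀D ht₀T
    | succ n ih =>
      have hscale : μ * (t₀ / μ ^ (n + 1)) = t₀ / μ ^ n := by
        rw [pow_succ]; field_simp
      constructor
      · intro hmem
        exact ih.1 (hscale ▸ (hDinv _).1 hmem)
      · intro hmem
        exact ih.2 (hscale ▸ (hTinv _).1 hmem)
  have hinv1 : μ⁻¹ < 1 := inv_lt_one_of_one_lt₀ hμ
  have hinv0 : 0 ≤ μ⁻¹ := le_of_lt (inv_pos.2 hμ0)
  obtain ⟨n, hn⟩ := exists_pow_lt_of_lt_one (div_pos hr ht₀) hinv1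
  refine ⟨t₀ / μ ^ n, ⟨by positivity, ?_⟩, (hdown n).1, (hdown n).2⟩
  have : t₀ / μ ^ n = t₀ * μ⁻¹ ^ n := by rw [inv_pow, div_eq_mul_inv]
  rw [this]
  calc t₀ * μ⁻¹ ^ n < t₀ * (r / t₀) := by gcongr
    _ = r := by field_simp

/-! ## Card `energy-cones`: the two-norm cone-field comb lemma

Points live in `E` (norm ‖·‖ = the strong, well-posedness norm), but differences are measured
through a continuous linear `ι : E →L[ℝ] F` (the weak norm in which quasilinear difference /
energy estimates close). No Fréchet differentiability of `T` is assumed: only continuity in `E`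
on a small `E`-ball and CONE CONDITIONS in the weak norm (forward invariance + `t`-expansion of the
unstable cone, `ι`-contraction on the stable cone). Seeds are weakly-Lipschitz graphs over the
stable directions at heights `σ₁ > 0 > σ₂` on the unstable axis. Conclusion: verbatim the
conclusion of `CombLemma` (lamination chart `Φ` continuous on an `E`-ball, `K` two-sided). -/
def ConeCombLemma : Prop :=
  ∀ (E F : Type) [NormedAddCommGroup E] [NormedSpace ℝ E] [CompleteSpace E]
    [NormedAddCommGroup F] [NormedSpace ℝ F] (ι : E →L[ℝ] F)
    (T : E × ℝ → E × ℝ) (θ μ α β r₀ : ℝ),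
    T 0 = 0 → 0 < r₀ → 0 ≤ θ → θ < 1 → 1 < μ → 0 ≤ β → β < α →
    ContinuousOn T (Metric.ball 0 r₀) →
    (∀ p ∈ Metric.ball (0 : E × ℝ) r₀, ∀ q ∈ Metric.ball (0 : E × ℝ) r₀,
        α * ‖ι (p.1 - q.1)‖ ≤ |p.2 - q.2| →
          α * ‖ι ((T p).1 - (T q).1)‖ ≤ |(T p).2 - (T q).2| ∧
            μ * |p.2 - q.2| ≤ |(T p).2 - (T q).2|) →
    (∀ p ∈ Metric.ball (0 : E × ℝ) r₀, ∀ q ∈ Metric.ball (0 : E × ℝ) r₀,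
        |p.2 - q.2| ≤ α * ‖ι (p.1 - q.1)‖ →
          ‖ι ((T p).1 - (T q).1)‖ ≤ θ * ‖ι (p.1 - q.1)‖) →
    ∃ r₁ : ℝ, 0 < r₁ ∧ ∀ (σ₁ σ₂ : ℝ) (g₁ g₂ : E → ℝ),
      0 < σ₁ ∧ σ₁ < r₁ ∧ -r₁ < σ₂ ∧ σ₂ < 0 ∧ g₁ 0 = σ₁ ∧ g₂ 0 = σ₂ ∧
      (∃ r' : ℝ, 0 < r' ∧ ∀ x ∈ Metric.ball (0 : E) r', ∀ y ∈ Metric.ball (0 : E) r',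
          |g₁ x - g₁ y| ≤ β * ‖ι (x - y)‖ ∧ |g₂ x - g₂ y| ≤ β * ‖ι (x - y)‖) →
      ∀ ε : ℝ, 0 < ε → ∃ ρ : ℝ, 0 < ρ ∧ ∃ (Φ : E × ℝ → ℝ) (K : Set ℝ),
        Φ 0 = 0 ∧ (0 : ℝ) ∈ K ∧
        (∀ η : ℝ, 0 < η → (K ∩ Set.Ioo (0 - η) 0).Nonempty ∧ (K ∩ Set.Ioo 0 (0 + η)).Nonempty) ∧
        ContinuousOn Φ (Metric.ball 0 ρ) ∧
        ∀ p ∈ Metric.ball (0 : E × ℝ) ρ, Φ p ∈ K →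
          ((∀ n : ℕ, T^[n] p ∈ Metric.ball (0 : E × ℝ) ε) ∨
            (∃ n : ℕ, T^[n] p ∈ Metric.ball ((0 : E), σ₁) ε ∧ (T^[n] p).2 = g₁ (T^[n] p).1) ∨
            (∃ n : ℕ, T^[n] p ∈ Metric.ball ((0 : E), σ₂) ε ∧ (T^[n] p).2 = g₂ (T^[n] p).1))

end Summit.FinalStateConjecture.FinalStateConjecture.Cruxes.LaminatedThreshold.Ideas

end
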